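import Mathlib
import HarnessLib

/-!
# Route `CompletionRelayChain` — crux `RelayFrontStep` (item stmt-NavierStokesRegularity-24850), LINE `window_v2`:
  the PHASE-I CERTIFICATE TABLE FORMAT (§format v1 of `Cruxes/RelayFrontStep/CERT-SPEC-stub_frontCert.md` §9)

Definitions ONLY — the data type in which the certificate GENERATOR (seat ns-crc-p2, dss_41) presents the Phase-I
enclosure of the front block to the kernel, frozen by the LEAD (format owner). Phase I = validated Taylor-model
numerics of the 18 block amplitudes (old shells `k = −3 … 2` × modes `x, u, r`) on the FIXED interval
`[0, T*]`, `T* = 147/64`, step `h = 2^{−6}` (147 steps), time-Taylor order `p = 5`, Taylor models of degree `d = 2`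
in `q ≤ 6` named start parameters; every real is DYADIC, an integer `n` meaning `n · 2^{−P}` for one global
precision exponent `P`; the checker (separate file, with its soundness theorem `phaseI_of_check`) computes in `ℚ`.
"Node-recompute" layout: the tables carry, per sub-box and per node, the Taylor model of every component, the
a priori box of the step, and the generator's own inflation terms; the checker recomputes each step from node
`m` and tests containment in node `m + 1` (CERT-SPEC §9, checker semantics (0)–(3)).

Component index `c = 3·(k+3) + i` (`k = −3 … 2` outer, `i = 0,1,2 = x,u,r` inner); monomial order = graded
lexicographic in the `q` parameters up to total degree `2` (`(q+1)(q+2)/2` coefficients), parameters normalised to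
`[−1, 1]`; a component may be declared degree `0` (plain interval: one coefficient). Nothing is asserted; the
structures have no invariants (well-formedness is part of the checker). MODEL-lattice bookkeeping (rung
TL-M3-R64); nothing here is a statement about the Navier–Stokes equations; the crux is OPEN.
-/

-- the summit-side namespace `Summit.NavierStokesRegularity.NavierStokesRegularity.…` (single-conjunct summit,
-- D-0017) repeats a component by design; the dupNamespace linter would flag every declaration.
set_option linter.dupNamespace false

namespace Summit.NavierStokesRegularity.NavierStokesRegularity.Cruxes.RelayFrontStep.PhaseI

/-- One component of one node: the Taylor-model coefficients (graded-lex order in the sub-box parameters;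
a single entry for a degree-0 = interval component) and the remainder radius, all in units `2^{−P}`.
[this file; CERT-SPEC §9] -/
structure TMComp where
  /-- coefficients `c_β`, `|β| ≤ 2`, graded-lex; length `1` marks a degree-0 component -/
  coef : List ℤ
  /-- remainder radius `ρ ≥ 0`: the component lies in `Σ_β c_β θ^β + [−ρ, ρ]` for parameters `θ ∈ [−1,1]^q` -/
  rem : ℕ

/-- The generator's per-step, per-component inflation terms (units `2^{−P}`): bound of the order-`p+1`
Lagrange term on the a priori box, defect inflation `κ₁·4^k·√F̄·h`, forcing inflation (old shells `−4`, `3`) and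
the Gronwall/Lipschitz factor used on the step (as `factor − 1`). The checker re-derives lower bounds for each and
tests `≥`. [this file; CERT-SPEC §9] -/
structure StepInfl where
  /-- Lagrange remainder bound of the time-Taylor step -/
  lag : ℕ
  /-- defect inflation on the step -/
  dft : ℕ
  /-- forcing inflation on the step -/
  frc : ℕ
  /-- Gronwall factor minus one on the step -/
  grw : ℕ

/-- One node `m` (time `t_m = m·h`) of one sub-box: the 18 Taylor models, and — for the step `[t_m, t_{m+1}]`
starting here (empty lists at the last node) — the 18 a priori boxes and inflation records.
[this file; CERT-SPEC §9] -/
structure Node where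
  /-- the 18 Taylor models at time `t_m`, component order `c = 3(k+3)+i` -/
  tm : List TMComp
  /-- a priori boxes `[lo, hi]` valid on `[t_m, t_{m+1}]` (18 pairs; `[]` at the last node) -/
  apr : List (ℤ × ℤ)
  /-- inflation records of the step (18; `[]` at the last node) -/
  infl : List StepInfl

/-- One sub-box of the start box: its slice of the TM parameters, the remaining start coordinates as
intervals, the nodes `m = 0 … 147`, and the footer (end box at `T*`, shell energies at `T*`, envelope maxima of
old shells `0,1,2` on `[0,T*]`, upper Riemann sums of `u₂²` and `|r₂u₂|`). [this file; CERT-SPEC §9] -/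
structure SubBox where
  /-- lower ends of the TM-parameter slice (q entries) -/
  paramLo : List ℤ
  /-- upper ends of the TM-parameter slice (q entries) -/
  paramHi : List ℤ
  /-- lower ends of the other start coordinates of the block (18 − q entries, component order, parameters skipped) -/
  fixedLo : List ℤ
  /-- upper ends of the other start coordinates -/
  fixedHi : List ℤ
  /-- the nodes `m = 0 … 147` -/
  nodes : List Node
  /-- end box at `T*`, lower ends (18) -/
  endLo : List ℤ
  /-- end box at `T*`, upper ends (18) -/
  endHi : List ℤ
  /-- upper bounds of the shell energies `Σᵢ F i k (T*)`, `k = −3 … 2` (6) -/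
  energyHi : List ℤ
  /-- envelope maxima on `[0, T*]`: upper bounds of `F i k`, `i = 0,1,2`, `k = 0,1,2` (9, order `3k + i`) -/
  envMax : List ℤ
  /-- upper Riemann sum of `u₂²` over `[0, T*]` -/
  i1Up : ℤ
  /-- upper Riemann sum of `|r₂ u₂|` over `[0, T*]` -/
  i2Up : ℤ

/-- The whole Phase-I certificate: header (precision exponent `P`, the ordered list of TM start parameters as
component indices `c ∈ {0,…,17}`), the sub-boxes, and the global footer (hull of the sub-box footers = the END-BOX
the skeleton freezes). Fixed by the format: `T* = 147·2^{−6}`, `h = 2^{−6}`, `p = 5`, `d = 2`.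
[this file; CERT-SPEC §9] -/
structure Tables where
  /-- precision exponent: every integer entry `n` denotes `n · 2^{−P}` -/
  P : ℕ
  /-- the TM parameters, as component indices of the start state (length `q ≤ 6`) -/
  params : List ℕ
  /-- the sub-boxes -/
  boxes : List SubBox
  /-- global end box, lower ends (18) -/
  hullEndLo : List ℤ
  /-- global end box, upper ends (18) -/
  hullEndHi : List ℤ
  /-- global shell-energy upper bounds at `T*` (6) -/
  hullEnergyHi : List ℤ
  /-- global envelope maxima (9) -/
  hullEnvMax : List ℤ
  /-- global upper bound of `∫₀^{T*} u₂²` -/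
  hullI1Up : ℤ
  /-- global upper bound of `∫₀^{T*} |r₂u₂|` -/
  hullI2Up : ℤ

/-- The fixed numerals of the format: number of steps `147`, step exponent `6` (`h = 2^{−6}`, `T* = 147/64`),
time-Taylor order `5`, TM degree `2`. [this file; CERT-SPEC §9] -/
def steps : ℕ := 147

/-- Step exponent: `h = 2^{−hLog2}`. [this file] -/
def hLog2 : ℕ := 6

/-- Time-Taylor order of the step recursion. [this file] -/
def order : ℕ := 5

/-- Degree of the Taylor models in the start parameters. [this file] -/
def degree : ℕ := 2

/-- The value denoted by an integer entry at precision `P`: `n · 2^{−P}` (as a rational). [this file] -/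
def val (P : ℕ) (n : ℤ) : ℚ := (n : ℚ) / (2 : ℚ) ^ P

/-- Component index of (mode `i`, old shell `k`): `c = 3·(k+3) + i` for `k ∈ {−3,…,2}`, `i ∈ {0,1,2}`. [this file] -/
def compIndex (i : ℕ) (k : ℤ) : ℕ := 3 * (k + 3).toNat + i

/-- Number of graded-lex monomials of degree `≤ 2` in `q` parameters: `(q+1)(q+2)/2`. [this file] -/
def numCoef (q : ℕ) : ℕ := (q + 1) * (q + 2) / 2

end Summit.NavierStokesRegularity.NavierStokesRegularity.Cruxes.RelayFrontStep.PhaseI
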